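import Literature.NumberTheory.Automorphic.QuaternionAdelicTorus
import Literature.NumberTheory.Automorphic.QuaternionAlgebraAdelicMeasureProofs
import Literature.NumberTheory.Automorphic.AdelicGroupDataQuotientClosed
import Literature.NumberTheory.Automorphic.AdelicGroupDataQuotientUnimodular
import Literature.MeasureTheory.Group.InvariantQuotientAbelian
import Literature.MeasureTheory.Group.UnimodularOfCocompact
import Literature.MeasureTheory.Group.InvariantQuotientCompactFibre
import Literature.NumberTheory.Automorphic.AutomorphicQuotientKernelGeometric
import HarnessLib

/-!
# The conjugacy classes of `D^×` for the trace formula: centralisers, compactness, invariant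
measures
(Gelbart, *Automorphic forms on adele groups* (1975), Remark 9.23 and (10.14))

Topic `NumberTheory/Automorphic`; theorems only. For a division quaternion algebra `D` over a
number field `K` and the adelic group datum `𝒢 = AdelicGroupData.units K D`
(`G = D_𝔸ˣ`, `Γ = Dˣ`, `L = ℝ_{>0} · Dˣ`), this file discharges the per-class hypotheses of the
geometric side of the trace formula
(`AdelicGroupData.integral_quotientKernel_diag_eq_mul_tsum`, `AutomorphicQuotientKernelGeometric`)
for every `γ ∈ Γ`, with `G_γ = C_G(γ)` (Gelbart (1975), Remark 9.23: "`G_ℚ` consists of the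
centre and of regular elliptic elements"):

* `isClosed_centralizer_singleton` — `G_γ` is closed;
* `units_centralizer_eq_top_of_mem_bot` / the dichotomy `units_mem_bot_or_not` — a rational
  `γ` is either central (`γ ∈ K^×`, `G_γ = G`) or regular (`γ ∉ K`);
* `units_compactSpace_centralizer_quotient` — **`G_γ ⧸ (L ∩ G_γ)` is compact** for every
  `γ ∈ Γ`: for central `γ` it is `G ⧸ L`, compact by Fujisaki
  (`compactSpace_automorphicQuotient_units_holds`, through the criterion
  `compactSpace_quotient_subgroupOf_of_subset_mul`); for regular `γ` it is the torus statement
  `compactSpace_centralizer_quotient` (`QuaternionAdelicTorus`);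
* `units_isMulRightInvariant_haar` — **`D_𝔸ˣ` is unimodular**
  (`UnimodularOfCocompact.isMulRightInvariant_of_compactSpace_quotient` with the two-sided Haar
  measure of `L`, `AdelicGroupDataQuotientUnimodular`, and an automorphic measure);
* `units_exists_smulInvariantMeasure_quotient_centralizer`,
  `units_exists_smulInvariantMeasure_quotient_inf_centralizer` — **non-zero invariant measures
  finite on compact sets on `G ⧸ G_γ` and `G ⧸ (L ∩ G_γ)`** for every `γ ∈ Γ` (regular:
  `InvariantQuotientAbelian`, the tori being abelian; central: the automorphic measure
  transported to `G ⧸ (L ∩ G)` and a Dirac mass on the point `G ⧸ G`).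

Part of the inline (D-0026) decomposition of
`Literature.NumberTheory.Automorphic.strong_multiplicity_one_quaternionUnits`.

## References

* S. Gelbart, *Automorphic forms on adele groups*, Ann. of Math. Studies 83 (1975), Remark 9.23,
  (10.14) [Gelbart1975].
* M.-F. Vignéras, *Arithmétique des algèbres de quaternions*, LNM 800 (1980), Ch. III §1–2
  [VignerasLNM800].
-/

noncomputable section

open NumberField IsDedekindDomain MeasureTheory Measure Topology
open Literature.MeasureTheory.Group
open scoped NNReal ENNReal TensorProduct Pointwise

namespace Literature.NumberTheory.Automorphic

-- the coset spaces carry Borel σ-algebras supplied locally, not the quotient σ-algebra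
attribute [-instance] Quotient.instMeasurableSpace QuotientGroup.measurableSpace

universe u

/-! ### Generalities on centralisers in topological groups -/

section General

variable {G : Type*} [Group G] [TopologicalSpace G] [IsTopologicalGroup G] [T2Space G]

/-- The centraliser of an element of a Hausdorff topological group is closed. [folklore] -/
theorem isClosed_centralizer_singleton (γ : G) :
    IsClosed ((Subgroup.centralizer ({γ} : Set G) : Subgroup G) : Set G) := by
  have h : ((Subgroup.centralizer ({γ} : Set G) : Subgroup G) : Set G) = {g : G | γ * g = g * γ} := by
    ext g
    rw [SetLike.mem_coe, Subgroup.mem_centralizer_iff]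
    simp only [Set.mem_singleton_iff, forall_eq, Set.mem_setOf_eq]
  rw [h]
  exact isClosed_eq (continuous_const.mul continuous_id) (continuous_id.mul continuous_const)

omit [TopologicalSpace G] [IsTopologicalGroup G] [T2Space G] in
/-- Elements of `C_G(γ)` commute with `γ`. [folklore] -/
theorem mem_centralizer_singleton_comm (γ : G) :
    ∀ g ∈ Subgroup.centralizer ({γ} : Set G), g * γ = γ * g := fun _ hg =>
  ((Subgroup.mem_centralizer_iff.1 hg) γ rfl).symm

omit [TopologicalSpace G] [IsTopologicalGroup G] [T2Space G] in
/-- The centraliser of a central element is everything. [folklore] -/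
theorem centralizer_singleton_eq_top_of_mem_center {γ : G} (hγ : γ ∈ Subgroup.center G) :
    Subgroup.centralizer ({γ} : Set G) = ⊤ :=
  (Subgroup.centralizer_eq_top_iff_subset).2 (Set.singleton_subset_iff.2 hγ)

omit [IsTopologicalGroup G] [T2Space G] in
/-- **Cocompact criterion for `M ⧸ (L ⊓ M)` when `M = ⊤`**: if `G ⧸ L` is compact then so is
`M ⧸ (L ∩ M)` for `M = ⊤` (as the coset space of the subgroup `M`;
`compactSpace_quotient_subgroupOf_of_subset_mul`). [folklore] -/
theorem compactSpace_top_quotient_subgroupOf [IsTopologicalGroup G] [LocallyCompactSpace G]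
    (L M : Subgroup G) (hM : M = ⊤) [CompactSpace (G ⧸ L)] :
    CompactSpace (M ⧸ (L ⊓ M).subgroupOf M) := by
  obtain ⟨C, hC, hCuniv⟩ := exists_isCompact_image_mk_superset L (isCompact_univ (X := G ⧸ L))
  refine compactSpace_quotient_subgroupOf_of_subset_mul (L ⊓ M) M (by rw [hM]; exact isClosed_univ)
    hC (fun c _ => by rw [hM]; exact Subgroup.mem_top c) fun g _ => ?_
  obtain ⟨c, hc, hcg⟩ := hCuniv (Set.mem_univ (QuotientGroup.mk g : G ⧸ L))
  refine Set.mem_mul.2 ⟨c, hc, c⁻¹ * g, ⟨QuotientGroup.eq.1 hcg, by rw [hM]; exact Subgroup.mem_top _⟩,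
    by rw [mul_inv_cancel_left]⟩

end General

/-! ### The classes of `Dˣ` -/

section Classes

variable (K : Type) [Field K] [NumberField K] (D : Type u) [Ring D] [Algebra K D]

omit [NumberField K] in
/-- A rational unit is central or non-scalar. [folklore] -/
theorem units_mem_bot_or_not (d : Dˣ) :
    (∃ c : K, (d : D) = algebraMap K D c) ∨ (d : D) ∉ (⊥ : Subalgebra K D) := by
  by_cases h : (d : D) ∈ (⊥ : Subalgebra K D)
  · left
    obtain ⟨c, hc⟩ := Algebra.mem_bot.1 h
    exact ⟨c, hc.symm⟩
  · exact Or.inr h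

/-- For a scalar `γ = c ∈ Kˣ` the adelic centraliser is all of `D_𝔸ˣ`
(`inclAdelic_mem_center_of_eq_algebraMap`). [folklore] -/
theorem units_centralizer_eq_top_of_eq_algebraMap [Module.Finite K D] {d : Dˣ} {c : K}
    (hd : (d : D) = algebraMap K D c) :
    Subgroup.centralizer ({(AdelicGroupData.units K D).toAdelic d} :
      Set (AdelicGroupData.units K D).Adelic) = ⊤ :=
  centralizer_singleton_eq_top_of_mem_center (inclAdelic_mem_center_of_eq_algebraMap K D hd)

variable [Module.Finite K D]

/-- **`G_γ ⧸ (L ∩ G_γ)` is compact for every rational `γ ∈ Dˣ`** (`L = ℝ_{>0} · Dˣ`,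
`G_γ = C_{D_𝔸ˣ}(γ)`, `D` a division quaternion algebra; stated on the adelic group datum
`𝒢 = AdelicGroupData.units K D`, `γ = 𝒢.toAdelic d`): for `γ` central it is `D_𝔸ˣ ⧸ ℝ_{>0} Dˣ`,
compact by Fujisaki's theorem; for `γ` regular it is the torus statement
`compactSpace_centralizer_quotient` (Gelbart (1975), Remark 9.23: the volumes
`vol(Γ(γ) A \ G_γ)` are finite). [cite: Gelbart1975, Remark 9.23] -/
theorem units_compactSpace_centralizer_quotient [IsQuaternionAlgebra K D]
    (hdiv : ∀ x : D, x ≠ 0 → IsUnit x) {γ : (AdelicGroupData.units K D).Adelic}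
    (hγ : γ ∈ (AdelicGroupData.units K D).arithmeticSubgroup) :
    CompactSpace (↥(Subgroup.centralizer ({γ} : Set (AdelicGroupData.units K D).Adelic)) ⧸
      ((AdelicGroupData.units K D).quotientSubgroup ⊓
        Subgroup.centralizer ({γ} : Set (AdelicGroupData.units K D).Adelic)).subgroupOf
        (Subgroup.centralizer ({γ} : Set (AdelicGroupData.units K D).Adelic))) := by
  obtain ⟨d, rfl⟩ := hγ
  have h4 : Module.finrank K D = 4 := IsQuaternionAlgebra.finrank_eq_four (K := K) (D := D)
  rcases units_mem_bot_or_not K D d with ⟨c, hc⟩ | hd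
  · -- central: `G_γ = ⊤`, and `D_𝔸ˣ ⧸ L` is compact (Fujisaki)
    haveI : LocallyCompactSpace (AdeleRing (𝓞 K) K) := locallyCompactSpace_adeleRing' K
    haveI : T2Space (AdeleRing (𝓞 K) K) := t2Space_adeleRing K
    haveI : LocallyCompactSpace (adelicUnits K D) := inferInstance
    haveI : LocallyCompactSpace (AdelicGroupData.units K D).Adelic :=
      ‹LocallyCompactSpace (adelicUnits K D)›
    haveI hX : CompactSpace (AdelicGroupData.units K D).automorphicQuotient :=
      AdelicGroupData.compactSpace_automorphicQuotient_units_holds K D hdiv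
    haveI : CompactSpace ((AdelicGroupData.units K D).Adelic ⧸
        (AdelicGroupData.units K D).quotientSubgroup) := hX
    have htop : Subgroup.centralizer ({(AdelicGroupData.units K D).toAdelic d} :
        Set (AdelicGroupData.units K D).Adelic) = ⊤ :=
      units_centralizer_eq_top_of_eq_algebraMap K D hc
    exact compactSpace_top_quotient_subgroupOf (G := (AdelicGroupData.units K D).Adelic)
      (AdelicGroupData.units K D).quotientSubgroup _ htop
  · -- regular: the torus
    exact compactSpace_centralizer_quotient K D hdiv h4 d hd

end Classes

/-! ### Unimodularity of `D_𝔸ˣ` and the invariant measures on `G ⧸ G_γ`, `G ⧸ (L ∩ G_γ)` -/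

section Measures

variable (K : Type) [Field K] [NumberField K] (D : Type u) [Ring D] [Algebra K D]
  [IsQuaternionAlgebra K D]
  [MeasurableSpace (AdelicGroupData.units K D).Adelic] [BorelSpace (AdelicGroupData.units K D).Adelic]

attribute [local instance] AdelicGroupData.measurableSpaceQuotientForm
  AdelicGroupData.borelSpaceQuotientForm AdelicGroupData.smulInvariantMeasureQuotientForm
  AdelicGroupData.isFiniteMeasureOnCompactsQuotientForm AdelicGroupData.isFiniteMeasureQuotientForm

local notation "GD" => AdelicGroupData.units K D

omit [IsQuaternionAlgebra K D] [MeasurableSpace (AdelicGroupData.units K D).Adelic]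
  [BorelSpace (AdelicGroupData.units K D).Adelic] in
/-- The topological hypotheses on `D_𝔸ˣ`, keyed on the datum: locally compact, Hausdorff, second
countable (`D_𝔸 ≅ 𝔸_K⁴`; cf. `JacquetLanglandsMultiplicityOneProofs`). [folklore] -/
theorem units_adelic_topology [Module.Finite K D] :
    LocallyCompactSpace (AdelicGroupData.units K D).Adelic ∧
      T2Space (AdelicGroupData.units K D).Adelic ∧
      SecondCountableTopology (AdelicGroupData.units K D).Adelic := by
  haveI : LocallyCompactSpace (AdeleRing (𝓞 K) K) := locallyCompactSpace_adeleRing' K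
  haveI : T2Space (AdeleRing (𝓞 K) K) := t2Space_adeleRing K
  haveI i₁ : LocallyCompactSpace (adelicUnits K D) := inferInstance
  haveI i₂ : T2Space (adelicUnits K D) := t2Space_adelicUnits K D
  haveI i₃ : SecondCountableTopology (adelicUnits K D) := by
    haveI : SecondCountableTopology (AdeleRing (𝓞 K) K) := secondCountableTopology_adeleRing K
    haveI : SecondCountableTopology (ScalarExtension K (AdeleRing (𝓞 K) K) D) :=
      (ScalarExtension.coordHomeomorph K (AdeleRing (𝓞 K) K) D).secondCountableTopology
    haveI : SecondCountableTopology (ScalarExtension K (AdeleRing (𝓞 K) K) D)ᵐᵒᵖ :=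
      MulOpposite.opHomeomorph.symm.secondCountableTopology
    exact Units.isEmbedding_embedProduct.secondCountableTopology
  exact ⟨i₁, i₂, i₃⟩

/-- **`D_𝔸ˣ` is unimodular** for a division quaternion algebra `D`: every Haar measure of
`(AdelicGroupData.units K D).Adelic = (D ⊗ 𝔸_K)ˣ` is right invariant. By
`isMulRightInvariant_of_compactSpace_quotient` (`UnimodularOfCocompact`) for the closed subgroup
`L = ℝ_{>0} · Dˣ` (two-sided Haar measure, `isMulRightInvariant_quotientSubgroup_units`; compact
quotient, Fujisaki; automorphic measure, `exists_isAutomorphicMeasure_units_of_isUnit`).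
(Classically: reductive adelic groups are unimodular.) [cite: Gelbart1975, Remark 9.23] -/
theorem units_isMulRightInvariant_of_isHaarMeasure (hdiv : ∀ x : D, x ≠ 0 → IsUnit x)
    (ν : Measure (AdelicGroupData.units K D).Adelic) [IsHaarMeasure ν] :
    ν.IsMulRightInvariant := by
  have h4 : Module.finrank K D = 4 := IsQuaternionAlgebra.finrank_eq_four (K := K) (D := D)
  haveI : Nontrivial D := Module.nontrivial_of_finrank_pos (R := K) (by omega)
  obtain ⟨i₁, i₂, i₃⟩ := units_adelic_topology K D
  haveI := i₁; haveI := i₂; haveI := i₃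
  haveI hH : IsClosed ((GD).quotientSubgroup : Set (GD).Adelic) :=
    AdelicGroupData.isClosed_quotientSubgroup_units K D
  haveI : LocallyCompactSpace (GD).quotientSubgroup :=
    AdelicGroupData.locallyCompactSpace_quotientSubgroup_units K D
  haveI : SecondCountableTopology (GD).quotientSubgroup :=
    TopologicalSpace.Subtype.secondCountableTopology _
  set ρ : Measure (GD).quotientSubgroup := Measure.haar with hρ
  haveI : ρ.IsMulRightInvariant := AdelicGroupData.isMulRightInvariant_quotientSubgroup_units K D ρ
  have hρ0 : ρ ≠ 0 := fun h => by
    have h2 : 0 < ρ Set.univ := isOpen_univ.measure_pos ρ ⟨1, trivial⟩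
    rw [h] at h2
    exact lt_irrefl _ h2
  obtain ⟨μ, hμ⟩ := AdelicGroupData.exists_isAutomorphicMeasure_units_of_isUnit K D hdiv
  haveI := hμ
  haveI hX : CompactSpace (GD).automorphicQuotient :=
    AdelicGroupData.compactSpace_automorphicQuotient_units_holds K D hdiv
  haveI : CompactSpace ((GD).Adelic ⧸ (GD).quotientSubgroup) := hX
  exact isMulRightInvariant_of_compactSpace_quotient (GD).quotientSubgroup ρ μ ν
    (AdelicGroupData.IsAutomorphicMeasure.ne_zero (GD) μ) hρ0

/-- **A non-zero invariant measure finite on compact sets on `G ⧸ G_γ`** for every rational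
`γ = (GD).toAdelic d` (`G = D_𝔸ˣ`, `G_γ = C_G(γ)`): for regular `γ` the centraliser is a closed
abelian subgroup (`centralizer_inclAdelic_comm`) of the unimodular `G`, so
`InvariantQuotientAbelian` applies; for central `γ`, `G_γ = G` and a Dirac mass on the point
`G ⧸ G` will do. [cite: Gelbart1975, Remark 9.23] -/
theorem units_exists_smulInvariantMeasure_quotient_centralizer
    (hdiv : ∀ x : D, x ≠ 0 → IsUnit x) {γ : (AdelicGroupData.units K D).Adelic}
    (hγ : γ ∈ (AdelicGroupData.units K D).arithmeticSubgroup)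
    [MeasurableSpace ((AdelicGroupData.units K D).Adelic ⧸
      Subgroup.centralizer ({γ} : Set (AdelicGroupData.units K D).Adelic))]
    [BorelSpace ((AdelicGroupData.units K D).Adelic ⧸
      Subgroup.centralizer ({γ} : Set (AdelicGroupData.units K D).Adelic))] :
    ∃ μC : Measure ((AdelicGroupData.units K D).Adelic ⧸
        Subgroup.centralizer ({γ} : Set (AdelicGroupData.units K D).Adelic)),
      SMulInvariantMeasure (AdelicGroupData.units K D).Adelic _ μC ∧
        IsFiniteMeasureOnCompacts μC ∧ μC ≠ 0 := by
  obtain ⟨d, rfl⟩ := hγ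
  have h4 : Module.finrank K D = 4 := IsQuaternionAlgebra.finrank_eq_four (K := K) (D := D)
  haveI : Nontrivial D := Module.nontrivial_of_finrank_pos (R := K) (by omega)
  obtain ⟨i₁, i₂, i₃⟩ := units_adelic_topology K D
  haveI := i₁; haveI := i₂; haveI := i₃
  rcases units_mem_bot_or_not K D d with ⟨c, hc⟩ | hd
  · -- central: the quotient is a point
    have htop : (Subgroup.centralizer ({(GD).toAdelic d} : Set (GD).Adelic)) = ⊤ := units_centralizer_eq_top_of_eq_algebraMap K D hc
    have hfix : ∀ (g : (GD).Adelic) (x : (GD).Adelic ⧸ (Subgroup.centralizer ({(GD).toAdelic d} : Set (GD).Adelic))), g • x = x := by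
      intro g x
      induction x using QuotientGroup.induction_on with
      | H a =>
        rw [MulAction.Quotient.smul_mk, smul_eq_mul]
        refine QuotientGroup.eq.2 ?_
        rw [htop]; exact Subgroup.mem_top _
    refine ⟨Measure.dirac (QuotientGroup.mk 1), ⟨fun g s _ => ?_⟩, inferInstance, ?_⟩
    · congr 1
      ext x
      simp only [Set.mem_preimage, hfix]
    · intro h0
      have h1 : Measure.dirac (QuotientGroup.mk (1 : (GD).Adelic) : (GD).Adelic ⧸ (Subgroup.centralizer ({(GD).toAdelic d} : Set (GD).Adelic))) Set.univ = 0 := by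
        rw [h0]; rfl
      rw [Measure.dirac_apply_of_mem (Set.mem_univ _)] at h1
      exact one_ne_zero h1
  · -- regular: abelian closed centraliser in the unimodular group
    set ν : Measure (GD).Adelic := Measure.haar with hν
    haveI : ν.IsMulRightInvariant := units_isMulRightInvariant_of_isHaarMeasure K D hdiv ν
    exact exists_smulInvariantMeasure_isFiniteMeasureOnCompacts_quotient_of_comm (Subgroup.centralizer ({(GD).toAdelic d} : Set (GD).Adelic))
      (isClosed_centralizer_singleton _) (centralizer_inclAdelic_comm K D hdiv h4 d hd) ν

/-- **A non-zero invariant measure finite on compact sets on `G ⧸ (L ∩ G_γ)`** for every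
rational `γ = (GD).toAdelic d`: for regular `γ`, `L ∩ G_γ` is closed abelian
(`InvariantQuotientAbelian`); for central `γ`, `L ∩ G_γ = L` and the automorphic measure,
transported along `G ⧸ L ≃ G ⧸ (L ∩ G)`, will do. [cite: Gelbart1975, Remark 9.23] -/
theorem units_exists_smulInvariantMeasure_quotient_inf_centralizer
    (hdiv : ∀ x : D, x ≠ 0 → IsUnit x) {γ : (AdelicGroupData.units K D).Adelic}
    (hγ : γ ∈ (AdelicGroupData.units K D).arithmeticSubgroup)
    [MeasurableSpace ((AdelicGroupData.units K D).Adelic ⧸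
      ((AdelicGroupData.units K D).quotientSubgroup ⊓
        Subgroup.centralizer ({γ} : Set (AdelicGroupData.units K D).Adelic)))]
    [BorelSpace ((AdelicGroupData.units K D).Adelic ⧸
      ((AdelicGroupData.units K D).quotientSubgroup ⊓
        Subgroup.centralizer ({γ} : Set (AdelicGroupData.units K D).Adelic)))] :
    ∃ μH : Measure ((AdelicGroupData.units K D).Adelic ⧸
        ((AdelicGroupData.units K D).quotientSubgroup ⊓
          Subgroup.centralizer ({γ} : Set (AdelicGroupData.units K D).Adelic))),
      SMulInvariantMeasure (AdelicGroupData.units K D).Adelic _ μH ∧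
        IsFiniteMeasureOnCompacts μH ∧ μH ≠ 0 := by
  obtain ⟨d, rfl⟩ := hγ
  have h4 : Module.finrank K D = 4 := IsQuaternionAlgebra.finrank_eq_four (K := K) (D := D)
  haveI : Nontrivial D := Module.nontrivial_of_finrank_pos (R := K) (by omega)
  obtain ⟨i₁, i₂, i₃⟩ := units_adelic_topology K D
  haveI := i₁; haveI := i₂; haveI := i₃
  haveI hH : IsClosed ((GD).quotientSubgroup : Set (GD).Adelic) :=
    AdelicGroupData.isClosed_quotientSubgroup_units K D
  rcases units_mem_bot_or_not K D d with ⟨c, hc⟩ | hd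
  · -- central: `M = L`; transport an automorphic measure along `G ⧸ L ≃ G ⧸ M`
    have htop : (Subgroup.centralizer ({(GD).toAdelic d} : Set (GD).Adelic)) = ⊤ := units_centralizer_eq_top_of_eq_algebraMap K D hc
    have hLM : (GD).quotientSubgroup = (GD).quotientSubgroup ⊓ (Subgroup.centralizer ({(GD).toAdelic d} : Set (GD).Adelic)) := by rw [htop, inf_top_eq]
    obtain ⟨μ, hμ⟩ := AdelicGroupData.exists_isAutomorphicMeasure_units_of_isUnit K D hdiv
    haveI := hμ
    set e : (GD).Adelic ⧸ (GD).quotientSubgroup → (GD).Adelic ⧸ ((GD).quotientSubgroup ⊓ (Subgroup.centralizer ({(GD).toAdelic d} : Set (GD).Adelic))) :=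
      ⇑(Subgroup.quotientEquivOfEq hLM) with he
    have hec : Continuous e := by
      have h1 : Continuous (e ∘ (QuotientGroup.mk : (GD).Adelic → (GD).Adelic ⧸ (GD).quotientSubgroup)) :=
        by
        have : e ∘ (QuotientGroup.mk : (GD).Adelic → (GD).Adelic ⧸ (GD).quotientSubgroup) =
            (QuotientGroup.mk : (GD).Adelic → (GD).Adelic ⧸ ((GD).quotientSubgroup ⊓ (Subgroup.centralizer ({(GD).toAdelic d} : Set (GD).Adelic)))) := by
          funext a; exact Subgroup.quotientEquivOfEq_mk hLM a
        rw [this]; exact QuotientGroup.continuous_mk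
      exact QuotientGroup.isOpenQuotientMap_mk.continuous_comp_iff.1 h1
    have hem : Measurable e := hec.measurable
    have hsmul : ∀ (g : (GD).Adelic) (x : (GD).Adelic ⧸ (GD).quotientSubgroup), e (g • x) = g • e x := by
      intro g x
      induction x using QuotientGroup.induction_on with
      | H a => rfl
    refine ⟨Measure.map e (μ : Measure ((GD).Adelic ⧸ (GD).quotientSubgroup)),
      smulInvariantMeasure_map (M := (GD).Adelic) (α := (GD).Adelic ⧸ (GD).quotientSubgroup)
        (μ : Measure ((GD).Adelic ⧸ (GD).quotientSubgroup)) e hsmul hem,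
      ?_, ?_⟩
    · haveI : IsFiniteMeasure (Measure.map e (μ : Measure ((GD).Adelic ⧸ (GD).quotientSubgroup))) :=
        Measure.isFiniteMeasure_map _ e
      infer_instance
    · intro h0
      have h1 : Measure.map e (μ : Measure ((GD).Adelic ⧸ (GD).quotientSubgroup)) Set.univ = 0 := by
        rw [h0]; rfl
      rw [Measure.map_apply hem MeasurableSet.univ, Set.preimage_univ] at h1
      exact AdelicGroupData.IsAutomorphicMeasure.ne_zero (GD) μ (Measure.measure_univ_eq_zero.1 h1)
  · -- regular: abelian closed subgroup of the unimodular group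
    set ν : Measure (GD).Adelic := Measure.haar with hν
    haveI : ν.IsMulRightInvariant := units_isMulRightInvariant_of_isHaarMeasure K D hdiv ν
    have hcomm := centralizer_inclAdelic_comm K D hdiv h4 d hd
    exact exists_smulInvariantMeasure_isFiniteMeasureOnCompacts_quotient_of_comm
      ((GD).quotientSubgroup ⊓ (Subgroup.centralizer ({(GD).toAdelic d} : Set (GD).Adelic))) (hH.inter (isClosed_centralizer_singleton _))
      (fun x hx y hy => hcomm x hx.2 y hy.2) ν

end Measures

/-! ### The geometric side of the trace formula for `D^×` -/

section Assembly

variable (K : Type) [Field K] [NumberField K] (D : Type u) [Ring D] [Algebra K D]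
  [IsQuaternionAlgebra K D]
  [MeasurableSpace (AdelicGroupData.units K D).Adelic] [BorelSpace (AdelicGroupData.units K D).Adelic]
  [∀ γ : (AdelicGroupData.units K D).Adelic, MeasurableSpace ((AdelicGroupData.units K D).Adelic ⧸
    Subgroup.centralizer ({γ} : Set (AdelicGroupData.units K D).Adelic))]
  [∀ γ : (AdelicGroupData.units K D).Adelic, BorelSpace ((AdelicGroupData.units K D).Adelic ⧸
    Subgroup.centralizer ({γ} : Set (AdelicGroupData.units K D).Adelic))]
  [∀ γ : (AdelicGroupData.units K D).Adelic, MeasurableSpace ((AdelicGroupData.units K D).Adelic ⧸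
    ((AdelicGroupData.units K D).quotientSubgroup ⊓
      Subgroup.centralizer ({γ} : Set (AdelicGroupData.units K D).Adelic)))]
  [∀ γ : (AdelicGroupData.units K D).Adelic, BorelSpace ((AdelicGroupData.units K D).Adelic ⧸
    ((AdelicGroupData.units K D).quotientSubgroup ⊓
      Subgroup.centralizer ({γ} : Set (AdelicGroupData.units K D).Adelic)))]

attribute [local instance] AdelicGroupData.measurableSpaceQuotientForm
  AdelicGroupData.borelSpaceQuotientForm AdelicGroupData.smulInvariantMeasureQuotientForm
  AdelicGroupData.isFiniteMeasureOnCompactsQuotientForm AdelicGroupData.isFiniteMeasureQuotientForm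

local notation "GD" => AdelicGroupData.units K D

/-- **The geometric side of the trace formula for the multiplicative group of a division
quaternion algebra** (Gelbart (1975), Remark 9.23 and (10.14): for `G = D^×`, `G_ℚ Z_∞⁺ \ G_𝔸`
compact, `tr R(φ) = Σ_{[γ]} vol(Z_∞⁺ G_ℚ(γ) \ G_𝔸(γ)) ∫_{G_𝔸(γ)\G_𝔸} φ(x⁻¹ γ x) dx`). Let `D` be
a division quaternion algebra over the number field `K`, `𝒢 = AdelicGroupData.units K D`
(`G = D_𝔸ˣ`, `Γ = Dˣ`, `L = ℝ_{>0} · Dˣ`, `X = G ⧸ L` compact by Fujisaki), `μ` an automorphic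
measure on `X`, `α` a Haar measure on `A_G = ℝ_{>0}` and `ρ` a Haar measure on `L` (the topological
instance hypotheses hold by `units_adelic_topology`, `isClosed_quotientSubgroup_units` and
`isMulRightInvariant_quotientSubgroup_units`; they are binders only because the kernel
`quotientKernel` is stated under them). Then there are
a constant `κ > 0` (`ρ = κ • (α ⊗ counting)`), constants `d_c ∈ (0, ∞)` and non-zero
`G`-invariant Borel measures `μ_c` finite on compact sets on `G ⧸ G_{γ_c}`, indexed by the
conjugacy classes `c` of `Γ` with representatives `γ_c = out c` and `G_{γ_c} = C_G(γ_c)`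
(for regular `γ_c` the torus `K(γ_c)_𝔸ˣ`, for central `γ_c` all of `G`), such that for every
`Φ ∈ C_c(D_𝔸ˣ)`, with `Φ_A(g) = ∫_{A_G} Φ(a⁻¹ g) dα(a)` and the kernel `K_Φ` of `R(Φ)`
(`quotientKernel`): every orbital integrand `y ↦ Φ_A(y γ_c y⁻¹)` is `μ_c`-integrable, the series
converges absolutely, and

  `∫_X K_Φ(x, x) dμ(x) = κ Σ'_c d_c ∫_{G ⧸ G_{γ_c}} Φ_A(y γ_c y⁻¹) dμ_c(y)`.

All per-class inputs are PROVED here (`units_compactSpace_centralizer_quotient`,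
`units_exists_smulInvariantMeasure_quotient_centralizer`,
`units_exists_smulInvariantMeasure_quotient_inf_centralizer`, unimodularity of `D_𝔸ˣ`), the
assembly being `AdelicGroupData.integral_quotientKernel_diag_eq_mul_tsum`. Together with
`hasSum_norm_sq_integratedOperator_rightRegular_eq_diagonal` (`Σ_i ‖R(f) e_i‖² =
c⁻¹ ∫_X K_{f ⋆ f^*}(x, x) dμ`) this is the trace formula for the Hilbert–Schmidt norm of `R(f)` on
`L²(X)` in geometric form. CAVEAT: `κ`, `d_c` and the measures `μ_c` are not normalised (the
printed constants are Tamagawa volumes); the spectral side (decomposition of `R` into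
irreducibles with multiplicities) is not treated here.
[cite: Gelbart1975, Remark 9.23 and (10.14)] -/
theorem units_integral_quotientKernel_diag_eq_mul_tsum (hdiv : ∀ x : D, x ≠ 0 → IsUnit x)
    [LocallyCompactSpace (GD).Adelic] [SecondCountableTopology (GD).Adelic] [T2Space (GD).Adelic]
    [hH : IsClosed ((GD).quotientSubgroup : Set (GD).Adelic)]
    (μ : Measure (GD).automorphicQuotient) [(GD).IsAutomorphicMeasure μ]
    (α : Measure (GD).center') [α.IsHaarMeasure] [SFinite α]
    (ρ : Measure (GD).quotientSubgroup) [ρ.IsHaarMeasure] [ρ.IsMulRightInvariant] [SFinite ρ] :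
    ∃ (κ : ℝ≥0) (dc : ConjClasses (GD).arithmeticSubgroup → ℝ≥0∞)
      (μC : ∀ c : ConjClasses (GD).arithmeticSubgroup, Measure ((GD).Adelic ⧸
        Subgroup.centralizer ({((Quotient.out c : (GD).arithmeticSubgroup) : (GD).Adelic)} :
          Set (GD).Adelic))),
      0 < κ ∧ (∀ c, dc c ≠ 0 ∧ dc c ≠ ∞) ∧
      (∀ c, SMulInvariantMeasure (GD).Adelic _ (μC c) ∧ IsFiniteMeasureOnCompacts (μC c) ∧
        μC c ≠ 0) ∧
      ∀ Φ : CompactlySupportedContinuousMap (GD).Adelic ℂ,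
        (∀ c, Integrable (descConj ((Quotient.out c : (GD).arithmeticSubgroup) : (GD).Adelic)
          (Subgroup.centralizer ({((Quotient.out c : (GD).arithmeticSubgroup) : (GD).Adelic)} :
            Set (GD).Adelic)) (mem_centralizer_singleton_comm _)
          (fun g => ∫ a, Φ ((a : (GD).Adelic)⁻¹ * g) ∂α)) (μC c)) ∧
        Summable (fun c => (dc c).toReal * ∫ y, ‖descConj
          ((Quotient.out c : (GD).arithmeticSubgroup) : (GD).Adelic)
          (Subgroup.centralizer ({((Quotient.out c : (GD).arithmeticSubgroup) : (GD).Adelic)} :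
            Set (GD).Adelic)) (mem_centralizer_singleton_comm _)
          (fun g => ∫ a, Φ ((a : (GD).Adelic)⁻¹ * g) ∂α) y‖ ∂(μC c)) ∧
        ∫ x, quotientKernel (GD).quotientSubgroup ρ Φ x x ∂μ =
          ((κ : ℝ) : ℂ) * ∑' c, ((dc c).toReal : ℂ) * ∫ y, descConj
            ((Quotient.out c : (GD).arithmeticSubgroup) : (GD).Adelic)
            (Subgroup.centralizer ({((Quotient.out c : (GD).arithmeticSubgroup) : (GD).Adelic)} :
              Set (GD).Adelic)) (mem_centralizer_singleton_comm _)
            (fun g => ∫ a, Φ ((a : (GD).Adelic)⁻¹ * g) ∂α) y ∂(μC c) := by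
  classical
  have h4 : Module.finrank K D = 4 := IsQuaternionAlgebra.finrank_eq_four (K := K) (D := D)
  haveI : Nontrivial D := Module.nontrivial_of_finrank_pos (R := K) (by omega)
  haveI : Countable (GD).arithmeticSubgroup := AdelicGroupData.countable_arithmeticSubgroup_units K D
  have hdisc : (GD).IsDiscreteRational := AdelicGroupData.units_isDiscreteRational_holds K D
  haveI : LocallyCompactSpace (AdeleRing (𝓞 K) K) := locallyCompactSpace_adeleRing' K
  obtain ⟨θ, hθc, hθA, hθa, hθγ⟩ := exists_centralRetraction_units K D
  have hρ0 : ρ ≠ 0 := fun h => by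
    have h2 : 0 < ρ Set.univ := isOpen_univ.measure_pos ρ ⟨1, trivial⟩
    rw [h] at h2
    exact lt_irrefl _ h2
  obtain ⟨κ, hκpos, hκ⟩ :=
    AdelicGroupData.exists_eq_smul_map_mul_prod_count (GD) hdisc θ hθc hθA hθa hθγ α ρ
  haveI hX : CompactSpace (GD).automorphicQuotient :=
    AdelicGroupData.compactSpace_automorphicQuotient_units_holds K D hdiv
  -- representatives and the per-class data
  have hrep : ∀ c : ConjClasses (GD).arithmeticSubgroup,
      ConjClasses.mk (Quotient.out c : (GD).arithmeticSubgroup) = c := fun c => by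
    rw [← ConjClasses.quotient_mk_eq_mk]; exact Quotient.out_eq c
  have hexC := fun c : ConjClasses (GD).arithmeticSubgroup =>
    units_exists_smulInvariantMeasure_quotient_centralizer K D hdiv
      (γ := ((Quotient.out c : (GD).arithmeticSubgroup) : (GD).Adelic)) (Quotient.out c).2
  choose μC hμCinv hμCfin hμC0 using hexC
  have hexH := fun c : ConjClasses (GD).arithmeticSubgroup =>
    units_exists_smulInvariantMeasure_quotient_inf_centralizer K D hdiv
      (γ := ((Quotient.out c : (GD).arithmeticSubgroup) : (GD).Adelic)) (Quotient.out c).2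
  choose μH hμHinv hμHfin hμH0 using hexH
  haveI : ∀ c, SMulInvariantMeasure (GD).Adelic _ (μC c) := hμCinv
  haveI : ∀ c, IsFiniteMeasureOnCompacts (μC c) := hμCfin
  haveI : ∀ c, SMulInvariantMeasure (GD).Adelic _ (μH c) := hμHinv
  haveI : ∀ c, IsFiniteMeasureOnCompacts (μH c) := hμHfin
  haveI : ∀ c : ConjClasses (GD).arithmeticSubgroup,
      IsClosed ((Subgroup.centralizer ({((Quotient.out c : (GD).arithmeticSubgroup) :
        (GD).Adelic)} : Set (GD).Adelic) : Subgroup (GD).Adelic) : Set (GD).Adelic) := fun c =>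
    isClosed_centralizer_singleton _
  haveI : ∀ c : ConjClasses (GD).arithmeticSubgroup,
      CompactSpace (↥(Subgroup.centralizer ({((Quotient.out c : (GD).arithmeticSubgroup) :
        (GD).Adelic)} : Set (GD).Adelic)) ⧸ ((GD).quotientSubgroup ⊓
        Subgroup.centralizer ({((Quotient.out c : (GD).arithmeticSubgroup) : (GD).Adelic)} :
          Set (GD).Adelic)).subgroupOf (Subgroup.centralizer
            ({((Quotient.out c : (GD).arithmeticSubgroup) : (GD).Adelic)} : Set (GD).Adelic))) :=
    fun c => units_compactSpace_centralizer_quotient K D hdiv (Quotient.out c).2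
  obtain ⟨dc, hdc, hId⟩ := AdelicGroupData.exists_lintegral_conjTsum_eq_tsum (GD) hdisc θ hθc hθA
    hθa hθγ (fun c => Quotient.out c) hrep
    (fun c => Subgroup.centralizer ({((Quotient.out c : (GD).arithmeticSubgroup) : (GD).Adelic)} :
      Set (GD).Adelic))
    (fun c => inf_le_right) (fun c => mem_centralizer_singleton_comm _) μ μH μC hμH0 hμC0
  refine ⟨κ, dc, μC, hκpos, hdc, fun c => ⟨hμCinv c, hμCfin c, hμC0 c⟩, fun Φ => ?_⟩
  exact AdelicGroupData.integral_quotientKernel_diag_eq_mul_tsum (GD) hdisc θ hθc hθA hθa hθγ α ρ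
    hκ (fun c => Quotient.out c)
    (fun c => Subgroup.centralizer ({((Quotient.out c : (GD).arithmeticSubgroup) : (GD).Adelic)} :
      Set (GD).Adelic))
    (fun c => mem_centralizer_singleton_comm _) μ μC hρ0 (fun c => (hdc c).1) hId Φ

end Assembly

end Literature.NumberTheory.Automorphic
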